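import Mathlib
import Literature.Analysis.Complex.CauchyTaylorBall
import Literature.MathematicalPhysics.QuantumFieldTheory.Balaban1983to89.MatrixLog

/-!
# Bałaban's abstract group average `M` ([B12] (0.5)–(0.9)): the quantitative first- and
# second-order estimates (0.8′), (0.8″) from analyticity, by Cauchy estimates along complex lines

**Citation header.**

* [B12] T. Bałaban, *Renormalization group approach to lattice gauge field theories.
  I. Generation of effective actions in a small field approximation and a coupling constant
  renormalization in four dimensions*, Commun. Math. Phys. **109** (1987) 249–301,
  bib key `Balaban1987RG1` — **p. 253, (0.5)–(0.9)** and **p. 254** (quoted below from the page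
  images `1987-cmp109-rg-I-small-field-p005-x2.png`, `-p006-x2.png` of the cell's reference
  set, not from an OCR layer).
* [B7] T. Bałaban, *Averaging operations for lattice gauge theories*, Commun. Math. Phys. **98**
  (1985) 17–51, bib key `Balaban1985Averaging` — the paper whose results [B12] p. 254 transfers
  to the abstract average; loci (47), (111)–(121), (162), (182)–(186).
* Cauchy estimates in one complex variable: folklore (e.g. W. Rudin, *Real and Complex
  Analysis*, 3rd ed., Thm. 10.26; for several variables / polydiscs L. Hörmander, *An
  Introduction to Complex Analysis in Several Variables* (1973), Thm. 2.2.7 «Cauchy's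
  inequalities»), formalised in the tree module `Literature.Analysis.Complex.CauchyTaylorBall`
  (sup bound on a disc ⇒ bounds on the first and second Taylor remainders at the centre); the
  reduction of the Banach-space case to one variable along complex lines is the standard one.

**The printed axioms ([B12] p. 253, verbatim).**  «Thus we have to define an average of a finite
set of group elements. We introduce an axiomatric definition of such an average. It is a
Gᶜ-valued function defined on sets {U_j : j = 1, 2, ..., n}, U_j ∈ Gᶜ, with sufficiently small
diameters. We denote it by {U_j}‾ = M({U_j}), and we assume that it is an analytic function
having the following properties:
  M({U_j⁻¹}) = M({U_j})⁻¹;                                                            (0.5)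
  M({uU_jv}) = uM({U_j})v;                                                            (0.6)
  M(π{U_j}) = M({U_j}) for an arbitrary permutation π of the set {U_j};               (0.7)
for a set {U_j} of elements close to the identity of the group, i.e. U_j = exp iA_j with A_j in
a small neighborhood of 0 in 𝔤ᶜ, the average is close to the identity also, and
  (1/i) log M({exp iA_j}) = (1/n) Σ_{j=1}^{n} A_j + (higher order terms);              (0.8)
  if U_j ∈ G, then M({U_j}) ∈ G also.                                                 (0.9)»
and ([B12] p. 253) «The considerations and results of this, and previous papers, do not depend
on any particular averaging operation used; they are valid universally for all averages
satisfying the above properties.»; ([B12] p. 254, on the average (0.12)) «This average has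
properties similar to the properties of the average introduced in (0.4), especially all results
of the paper [12] are valid for it. The proofs are in most cases unchanged; in others only minor
and obvious modifications are needed.» ([12] of [B12] = [B7]).

**What this file is for (cell `pub-balaban`, B7 sub-cell, gap row G-B7t-1).**  The transfer of
[B7]'s Propositions 1–6 / Theorem 2 to an abstract average `M` uses, besides the algebraic
axioms (0.5)–(0.7), (0.9), two *quantitative* forms of (0.8) and of «analytic» which [B12] does
not display (transfer census `b2b-balaban-b07/g2/transfer-census-B7-under-B12-average.md`,
items (U4), (U5); GAPS.md row G-B7t-1, NEEDED clause: «state (0.8′) [second-order remainder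
with named r_M, C_M] and (0.8″) [first-derivative closeness / Lipschitz L_M] as properties of
M, or derive them from analyticity with the constants named»):

* (0.8′) = (U4): `‖log M({exp X_j}) − n⁻¹ Σ_j X_j‖ ≤ C_M · (max_j ‖X_j‖)²` for
  `max_j ‖X_j‖ ≤ r_M` (used at [B7] (47), (111)–(121));
* (0.8″) = (U5): the derivative of `M` at a near-identity tuple is close to the arithmetic
  mean, `‖DM(U) W − n⁻¹ Σ_j W_j‖ ≤ C′_M · max_j ‖W_j‖ · max_j ‖U_j − 1‖`, and `M` is Lipschitz
  with a constant `L_M` near the identity tuple (used at [B7] (162), (182)–(186)).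

This module DERIVES (0.8′), (0.8″) and `L_M` — with the constants explicit in the two
parameters `(r, K)` below — from exactly the following reading of the printed hypotheses, for an
arbitrary map `M : (ι → 𝔄) → 𝔄` on tuples indexed by a finite type `ι` with values in a
complete normed `ℂ`-algebra `𝔄` (the ambient algebra of `Gᶜ`; tuples carry the sup norm
`‖U‖ = max_j ‖U_j‖`), see `IsAnalyticMean`:

* «we assume that it is an analytic function» on tuples «with sufficiently small diameters»,
  read (after the reduction by (0.6), see below) as: `M` is analytic on the polydisc
  `{U : max_j ‖U_j − 1‖ < r}` (`AnalyticOnNhd ℂ M (Metric.ball 1 r)`), `0 < r ≤ 1`;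
* «the average is close to the identity also», read as the sup bound `‖M(U) − 1‖ ≤ K` on that
  polydisc, `K ≤ 1/2` (so that `log M(U)` is the convergent Mercator series `MatrixLog.mlog`);
* (0.8) to zeroth and first order: `M(1, …, 1) = 1` and the Fréchet derivative of `M` at the
  identity tuple is the arithmetic mean `W ↦ n⁻¹ Σ_j W_j` (`meanCLM`).  (These two facts are
  what «(1/i) log M({exp iA_j}) = (1/n) Σ A_j + (higher order terms)» says to first order, the
  map `A ↦ {exp iA_j}` having derivative `i·id` at `0` and `(1/i) log` derivative `(1/i)·id` at
  `1`; the theorem `IsAnalyticMean.of_littleO` derives them from the literal little-o form of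
  (0.8) for the reader who prefers that reading.)

Reduction by (0.6): a tuple of small *diameter* `{U_j}` is `{(U_j U₁⁻¹) U₁}` with
`{U_j U₁⁻¹}` near the identity tuple, and (0.6) with `u = 1`, `v = U₁` gives
`M({U_j}) = M({U_j U₁⁻¹}) U₁`; so every statement about `M` near a small-diameter tuple is a
statement near the identity tuple, transported by a right multiplication.  This bookkeeping is
left to the consumer (it involves the group, not the analysis); the present file works on the
polydisc around the identity tuple only.

**Results (all constants explicit; `h : IsAnalyticMean M r K`).**

* `IsAnalyticMean.norm_sub_le` / `.norm_sub_le_near_one`: (0.8″), Lipschitz part —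
  `‖M(U + V) − M(U)‖ ≤ 4K‖V‖ / (r − ‖U − 1‖)` whenever `4‖V‖ ≤ r − ‖U − 1‖`; in particular
  `L_M = 8K/r` on `{‖U − 1‖ ≤ r/2}` for increments `‖V‖ ≤ r/8`.
* `IsAnalyticMean.norm_fderiv_apply_le`: `‖DM(U) W‖ ≤ 2K‖W‖ / (r − ‖U − 1‖)` (`≤ 4K‖W‖/r` for
  `‖U − 1‖ ≤ r/2`).
* `IsAnalyticMean.norm_fderiv_sub_mean_le`: (0.8″), derivative part = (U5) —
  `‖DM(U) W − n⁻¹ Σ_j W_j‖ ≤ 32 K ‖W‖ ‖U − 1‖ / r²` for `‖U − 1‖ ≤ r/8`; so `C′_M = 32K/r²`.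
* `IsAnalyticMean.norm_sub_sub_fderiv_le`: second-order Taylor remainder at any tuple of the
  polydisc — `‖M(U + V) − M(U) − DM(U) V‖ ≤ 8K‖V‖² / (r − ‖U − 1‖)²` for `4‖V‖ ≤ r − ‖U − 1‖`;
  at `U = 1`: `‖M(1 + V) − 1 − n⁻¹ Σ_j V_j‖ ≤ 8K‖V‖²/r²` (`.norm_sub_one_sub_mean_le`).
* `IsAnalyticMean.norm_mlog_exp_sub_mean_le`: (0.8′) = (U4) in the printed exp/log form —
  `‖mlog (M {exp X_j}) − n⁻¹ Σ_j X_j‖ ≤ 64 K ‖X‖² / r²` for `‖X‖ = max_j ‖X_j‖ ≤ r/8`; so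
  `r_M = r/8`, `C_M = 64K/r²` (and the group-level form `‖M{exp X_j} − 1 − n⁻¹ Σ X_j‖ ≤ 32K‖X‖²/r²`,
  `.norm_exp_sub_one_sub_mean_le`).
* `IsAnalyticMean.norm_fderiv_mlog_sub_mean_le`: (U5) in log form —
  `‖D(mlog ∘ M)(U) W − n⁻¹ Σ_j W_j‖ ≤ 64 K ‖W‖ ‖U − 1‖ / r²` for `‖U − 1‖ ≤ r/8`.

* (v1.1, §4 — consumer forms) `IsAnalyticMean.norm_mlog_sub_mean_mlog_le`: (0.8′) for a
  near-identity tuple of GROUP elements, the form consumed at [B7] (47) with `A_j = (1/i) log U_j` —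
  `‖mlog (M U) − n⁻¹ Σ_j mlog U_j‖ ≤ 256 K ‖U − 1‖² / r²` for `‖U − 1‖ ≤ r/16`;
  `IsAnalyticMean.norm_mlog_comp_sub_sub_fderiv_le`: second-order remainder of `mlog ∘ M` at any
  tuple (`16K‖V‖²/(r − ‖U − 1‖)²`); `IsAnalyticMean.norm_mlog_expMul_sub_mlog_sub_mean_le`:
  (U5) in the census's USE-FORM — for `‖Z − 1‖ ≤ r/8`, `‖a‖ ≤ r/16`,
  `‖mlog M({exp(a_j) Z_j}) − mlog M({Z_j}) − n⁻¹ Σ_j a_j‖ ≤ (2 + 192K/r²)‖a‖‖Z − 1‖ + (1 + 192K/r²)‖a‖²`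
  (the census's `O_M(ρ · max‖a_j‖) + O_M((max‖a_j‖)²)` with both constants explicit; the census
  writes `log [M({e^{a_j}Z_j}) M({Z_j})⁻¹]`, which differs from the difference of logarithms by
  terms of the same two types — consumer's algebra with (26)); and the exponential-series bound
  `norm_exp_sub_one_sub_self_le` `‖exp Y − 1 − Y‖ ≤ e^{‖Y‖} − 1 − ‖Y‖` (hence `≤ ‖Y‖²` for
  `‖Y‖ ≤ 1`, the tree's `Literature.Analysis.Complex.norm_exp_sub_one_sub_le`).

The factor `i` of the printed `exp iA_j`, `(1/i) log` is absorbed into `X_j = iA_j ∈ 𝔤ᶜ ⊆ 𝔄`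
(the estimates are over `ℂ` and blind to it).

**Method.**  Every estimate is a ONE-complex-variable Cauchy estimate for the restriction of `M`
(or of `U ↦ DM(U) W`, or of `mlog ∘ M`) to a complex line or to the curve
`t ↦ {exp (t X_j)}`, through `Literature.Analysis.Complex.CauchyTaylorBall`
(`norm_sub_le_of_forall_mem_ball`, `norm_sub_sub_le_of_forall_mem_ball`,
`norm_deriv_le_of_forall_mem_ball`); the derivative `U ↦ DM(U)` is again analytic
(`AnalyticOnNhd.fderiv`), which gives (U5) by the first-order estimate applied to it.  The
generic engine (§1) is stated for any map between complex normed spaces and may be reused.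

**M-dependence ledger for the [B7] transfer (G-B7t-1 (m1)–(m4)).**  With the constants above,
the O_M-terms of the census become: (47′) `C_M = 64K/r²` on `max‖X_j‖ ≤ r/8`; Prop. 4/5
((111)–(121)): the same `C_M`, and the Lipschitz constant `8K/r`; Prop. 6 ((182)–(186)):
`C′_M = 32K/r²` (group form) / `64K/r²` (log form) and `L_M = 8K/r`, or directly the use-form
constants `(2 + 192K/r², 1 + 192K/r²)` of §4 on `‖Z − 1‖ ≤ r/8`, `max‖a_j‖ ≤ r/16`; the standing small-field
constraint (m1) is `max_j ‖U_j U₁⁻¹ − 1‖ < r` (after the (0.6) reduction), strengthened to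
`≤ r/8` where the second-order forms are used.  No constant of [B7] other than these acquires an
`M`-dependence through (0.8′)/(0.8″).

**Absolute-rule boundary.**  Nothing in this file is a cited fact: the printed axioms enter as
the FIELDS of the hypothesis structure `IsAnalyticMean` (binders, to be discharged by whoever
supplies a concrete complex-analytic average; no instance is constructed here — in particular
none for the printed average (0.10) and none for the tree's `SU(2)` inhabitant `su2GroupMean` of
`BlockAveragingTwoLevel`), and every `theorem` is kernel-checked from them by elementary complex
analysis.  Relation to the tree's `GroupAverage` (module `Setup`): that structure types the
ALGEBRAIC axioms (0.5)–(0.7) of a `G`-valued average on small-diameter `G`-families and, as its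
docstring records, deliberately does not encode `Gᶜ`-values, analyticity or (0.8); the present
structure is exactly that complementary analytic half, stated on the ambient algebra `𝔄` (the two
are independent hypotheses on a candidate average and neither implies the other).  In particular the file
does not assert that any specific average satisfies `IsAnalyticMean`, and it does not touch
[B7]'s lattice objects.

**WHAT IS REPRODUCED:** the routine-but-unwritten derivation «analytic + (0.8) ⇒ (0.8′), (0.8″)
with named constants» behind [B12] p. 254 «all results of the paper [12] are valid for it … only
minor and obvious modifications are needed», i.e. the NEEDED clause of GAPS.md G-B7t-1 for the
items (U4), (U5) and `L_M` of the transfer census; not any theorem of [B7] or [B12] themselves.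
-/

noncomputable section

open Set Filter Metric NormedSpace
open scoped Topology

namespace Literature.MathematicalPhysics.QuantumFieldTheory.Balaban1983to89

namespace B7TransferAnalyticMean

open Literature.Analysis.Complex

/-! ## §1. Generic engine: Cauchy estimates along complex lines for maps of normed spaces -/

section Engine

variable {E F : Type*} [NormedAddCommGroup E] [NormedSpace ℂ E]
  [NormedAddCommGroup F] [NormedSpace ℂ F] [CompleteSpace F]
  {Φ : E → F} {x₀ : E} {r B : ℝ}

/-- A point of the complex line `t ↦ u + t • v` lies in `ball x₀ r` as soon as
`‖u - x₀‖ + ‖t‖ ‖v‖ < r`. [folklore] -/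
theorem add_smul_mem_ball {u v : E} {t : ℂ} (h : ‖u - x₀‖ + ‖t‖ * ‖v‖ < r) :
    u + t • v ∈ ball x₀ r := by
  rw [mem_ball, dist_eq_norm]
  calc ‖u + t • v - x₀‖ = ‖(u - x₀) + t • v‖ := by abel_nf
    _ ≤ ‖u - x₀‖ + ‖t • v‖ := norm_add_le _ _
    _ = ‖u - x₀‖ + ‖t‖ * ‖v‖ := by rw [norm_smul]
    _ < r := h

/-- The line `t ↦ u + t • v`, `‖t‖ < (r - ‖u - x₀‖)/‖v‖`, stays in `ball x₀ r`. [folklore] -/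
theorem add_smul_mem_ball_of_norm_lt {u v : E} (hv : 0 < ‖v‖) {t : ℂ}
    (ht : ‖t‖ < (r - ‖u - x₀‖) / ‖v‖) : u + t • v ∈ ball x₀ r := by
  apply add_smul_mem_ball
  have := (lt_div_iff₀ hv).mp ht
  linarith

omit [CompleteSpace F] in
/-- The restriction of a `ℂ`-differentiable map to a complex line is differentiable. [folklore] -/
theorem differentiableOn_comp_line (hΦ : DifferentiableOn ℂ Φ (ball x₀ r)) {u v : E} {R : ℝ}
    (hmaps : ∀ t : ℂ, ‖t‖ < R → u + t • v ∈ ball x₀ r) :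
    DifferentiableOn ℂ (fun t : ℂ => Φ (u + t • v)) (ball 0 R) := by
  have hγ : Differentiable ℂ (fun t : ℂ => u + t • v) :=
    (differentiable_const u).add (differentiable_id.smul_const v)
  refine hΦ.comp hγ.differentiableOn ?_
  intro t ht
  exact hmaps t (mem_ball_zero_iff.mp ht)

/-- The complex line `t ↦ u + t • v` has derivative `v`. [folklore] -/
theorem hasDerivAt_line (u v : E) (t : ℂ) : HasDerivAt (fun s : ℂ => u + s • v) v t := by
  have h := ((hasDerivAt_id t).smul_const v).const_add u
  simpa using h

/-- **First-order Cauchy estimate along a line (Lipschitz bound).**  If `Φ` is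
`ℂ`-differentiable on `ball x₀ r` with `‖Φ‖ ≤ B` there, `u ∈ ball x₀ r` and
`4‖v‖ ≤ r - ‖u - x₀‖`, then `‖Φ (u + v) - Φ u‖ ≤ 4 B ‖v‖ / (r - ‖u - x₀‖)`. [folklore] -/
theorem norm_sub_le_of_line (hΦ : DifferentiableOn ℂ Φ (ball x₀ r))
    (hB : ∀ y ∈ ball x₀ r, ‖Φ y‖ ≤ B) {u v : E} (hu : u ∈ ball x₀ r)
    (hv : 4 * ‖v‖ ≤ r - ‖u - x₀‖) :
    ‖Φ (u + v) - Φ u‖ ≤ 4 * B * ‖v‖ / (r - ‖u - x₀‖) := by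
  have hgap : 0 < r - ‖u - x₀‖ := by
    rw [mem_ball, dist_eq_norm] at hu; linarith
  by_cases hv0 : v = 0
  · subst hv0; simp
  have hvpos : 0 < ‖v‖ := norm_pos_iff.mpr hv0
  set R : ℝ := (r - ‖u - x₀‖) / ‖v‖ with hR
  have hRpos : 0 < R := div_pos hgap hvpos
  have hmaps : ∀ t : ℂ, ‖t‖ < R → u + t • v ∈ ball x₀ r :=
    fun t ht => add_smul_mem_ball_of_norm_lt hvpos ht
  have hd := differentiableOn_comp_line hΦ hmaps
  have hBl : ∀ t ∈ ball (0 : ℂ) R, ‖Φ (u + t • v)‖ ≤ B :=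
    fun t ht => hB _ (hmaps t (mem_ball_zero_iff.mp ht))
  have hz : ‖(1 : ℂ) - 0‖ ≤ R / 4 := by
    rw [sub_zero, norm_one]
    have : 4 ≤ R := by
      rw [hR, le_div_iff₀ hvpos]; linarith
    linarith
  have h := norm_sub_le_of_forall_mem_ball (f := fun t : ℂ => Φ (u + t • v)) (c := 0)
    hRpos hd hBl hz
  simp only [one_smul, zero_smul, add_zero, sub_zero, norm_one, mul_one] at h
  calc ‖Φ (u + v) - Φ u‖ ≤ 4 * B / R := h
    _ = 4 * B * ‖v‖ / (r - ‖u - x₀‖) := by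
        rw [hR]; field_simp

/-- **Cauchy estimate for a directional derivative.**  If `Φ` is `ℂ`-differentiable on
`ball x₀ r` with `‖Φ‖ ≤ B` there and `u ∈ ball x₀ r`, then
`‖DΦ(u) w‖ ≤ 2 B ‖w‖ / (r - ‖u - x₀‖)`. [folklore] -/
theorem norm_fderiv_apply_le_of_line (hΦ : DifferentiableOn ℂ Φ (ball x₀ r))
    (hB : ∀ y ∈ ball x₀ r, ‖Φ y‖ ≤ B) {u : E} (hu : u ∈ ball x₀ r) (w : E) :
    ‖fderiv ℂ Φ u w‖ ≤ 2 * B * ‖w‖ / (r - ‖u - x₀‖) := by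
  have hgap : 0 < r - ‖u - x₀‖ := by
    rw [mem_ball, dist_eq_norm] at hu; linarith
  by_cases hw0 : w = 0
  · subst hw0; simp
  have hwpos : 0 < ‖w‖ := norm_pos_iff.mpr hw0
  set R : ℝ := (r - ‖u - x₀‖) / ‖w‖ with hR
  have hRpos : 0 < R := div_pos hgap hwpos
  have hmaps : ∀ t : ℂ, ‖t‖ < R → u + t • w ∈ ball x₀ r :=
    fun t ht => add_smul_mem_ball_of_norm_lt hwpos ht
  have hd := differentiableOn_comp_line hΦ hmaps
  have hBl : ∀ t ∈ ball (0 : ℂ) R, ‖Φ (u + t • w)‖ ≤ B :=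
    fun t ht => hB _ (hmaps t (mem_ball_zero_iff.mp ht))
  have hderiv : HasDerivAt (fun t : ℂ => Φ (u + t • w)) (fderiv ℂ Φ u w) 0 := by
    have hΦu : HasFDerivAt Φ (fderiv ℂ Φ u) (u + (0 : ℂ) • w) := by
      rw [zero_smul, add_zero]
      exact (hΦ.differentiableAt (isOpen_ball.mem_nhds hu)).hasFDerivAt
    exact hΦu.comp_hasDerivAt (0 : ℂ) (hasDerivAt_line u w 0)
  have h := norm_deriv_le_of_forall_mem_ball hRpos hd hBl
  rw [hderiv.deriv] at h
  calc ‖fderiv ℂ Φ u w‖ ≤ 2 * B / R := h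
    _ = 2 * B * ‖w‖ / (r - ‖u - x₀‖) := by
        rw [hR]; field_simp

/-- **Second-order Cauchy estimate along an analytic curve.**  If `Φ` is `ℂ`-differentiable on
`ball x₀ r` with `‖Φ‖ ≤ B` there, and `γ : ℂ → E` is differentiable on `ball 0 R`, `R ≥ 4`,
maps it into `ball x₀ r`, with `γ 0 = u` and `γ'(0) = v`, then
`‖Φ (γ 1) - Φ u - DΦ(u) v‖ ≤ 8 B / R²`. [folklore] -/
theorem norm_sub_sub_fderiv_le_of_curve (hΦ : DifferentiableOn ℂ Φ (ball x₀ r))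
    (hB : ∀ y ∈ ball x₀ r, ‖Φ y‖ ≤ B) {γ : ℂ → E} {u v : E} {R : ℝ} (hR : 4 ≤ R)
    (hγd : DifferentiableOn ℂ γ (ball 0 R)) (hγm : MapsTo γ (ball 0 R) (ball x₀ r))
    (hγ0 : γ 0 = u) (hγ' : HasDerivAt γ v 0) :
    ‖Φ (γ 1) - Φ u - fderiv ℂ Φ u v‖ ≤ 8 * B / R ^ 2 := by
  have hRpos : 0 < R := by linarith
  have hd : DifferentiableOn ℂ (Φ ∘ γ) (ball 0 R) := hΦ.comp hγd hγm
  have hBl : ∀ t ∈ ball (0 : ℂ) R, ‖(Φ ∘ γ) t‖ ≤ B := fun t ht => hB _ (hγm ht)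
  have hu : u ∈ ball x₀ r := hγ0 ▸ hγm (mem_ball_self hRpos)
  have hderiv : HasDerivAt (Φ ∘ γ) (fderiv ℂ Φ u v) 0 := by
    have hΦu : HasFDerivAt Φ (fderiv ℂ Φ u) (γ 0) := by
      rw [hγ0]
      exact (hΦ.differentiableAt (isOpen_ball.mem_nhds hu)).hasFDerivAt
    exact hΦu.comp_hasDerivAt (0 : ℂ) hγ'
  have hz : ‖(1 : ℂ) - 0‖ ≤ R / 4 := by
    rw [sub_zero, norm_one]; linarith
  have h := norm_sub_sub_le_of_forall_mem_ball (f := Φ ∘ γ) (c := 0) hRpos hd hBl hz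
  rw [hderiv.deriv] at h
  simpa only [Function.comp_apply, sub_zero, one_smul, norm_one, one_pow, mul_one, hγ0] using h

/-- Second-order Cauchy estimate along a LINE: `‖Φ (u + v) - Φ u - DΦ(u) v‖ ≤
8 B ‖v‖² / (r - ‖u - x₀‖)²` whenever `4‖v‖ ≤ r - ‖u - x₀‖`. [folklore] -/
theorem norm_sub_sub_fderiv_le_of_line (hΦ : DifferentiableOn ℂ Φ (ball x₀ r))
    (hB : ∀ y ∈ ball x₀ r, ‖Φ y‖ ≤ B) {u v : E} (hu : u ∈ ball x₀ r)
    (hv : 4 * ‖v‖ ≤ r - ‖u - x₀‖) :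
    ‖Φ (u + v) - Φ u - fderiv ℂ Φ u v‖ ≤ 8 * B * ‖v‖ ^ 2 / (r - ‖u - x₀‖) ^ 2 := by
  have hgap : 0 < r - ‖u - x₀‖ := by
    rw [mem_ball, dist_eq_norm] at hu; linarith
  by_cases hv0 : v = 0
  · subst hv0; simp
  have hvpos : 0 < ‖v‖ := norm_pos_iff.mpr hv0
  set R : ℝ := (r - ‖u - x₀‖) / ‖v‖ with hR
  have hR4 : 4 ≤ R := by rw [hR, le_div_iff₀ hvpos]; linarith
  have hγd : DifferentiableOn ℂ (fun t : ℂ => u + t • v) (ball 0 R) :=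
    ((differentiable_const u).add (differentiable_id.smul_const v)).differentiableOn
  have hγm : MapsTo (fun t : ℂ => u + t • v) (ball 0 R) (ball x₀ r) :=
    fun t ht => add_smul_mem_ball_of_norm_lt hvpos (mem_ball_zero_iff.mp ht)
  have hγ0 : (fun t : ℂ => u + t • v) 0 = u := by simp
  have h := norm_sub_sub_fderiv_le_of_curve hΦ hB hR4 hγd hγm hγ0 (hasDerivAt_line u v 0)
  simp only [one_smul] at h
  calc ‖Φ (u + v) - Φ u - fderiv ℂ Φ u v‖ ≤ 8 * B / R ^ 2 := h
    _ = 8 * B * ‖v‖ ^ 2 / (r - ‖u - x₀‖) ^ 2 := by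
        rw [hR]; field_simp

/-- **Derivative closeness from analyticity.**  If `Φ` is analytic on `ball x₀ r` (`r > 0`) with
`‖Φ‖ ≤ B` there, then for `‖u - x₀‖ ≤ r/8` and every direction `w`,
`‖DΦ(u) w - DΦ(x₀) w‖ ≤ 32 B ‖w‖ ‖u - x₀‖ / r²` (the first-order estimate applied to the
analytic map `y ↦ DΦ(y) w`, which is bounded by `4B‖w‖/r` on `ball x₀ (r/2)`). [folklore] -/
theorem norm_fderiv_sub_fderiv_le (hr : 0 < r) (hΦ : AnalyticOnNhd ℂ Φ (ball x₀ r))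
    (hB : ∀ y ∈ ball x₀ r, ‖Φ y‖ ≤ B) {u : E} (hu : ‖u - x₀‖ ≤ r / 8) (w : E) :
    ‖fderiv ℂ Φ u w - fderiv ℂ Φ x₀ w‖ ≤ 32 * B * ‖w‖ * ‖u - x₀‖ / r ^ 2 := by
  have hBnn : 0 ≤ B := (norm_nonneg _).trans (hB x₀ (mem_ball_self hr))
  set Ψ : E → F := fun y => fderiv ℂ Φ y w with hΨ
  have hsub : ball x₀ (r / 2) ⊆ ball x₀ r := ball_subset_ball (by linarith)
  have hΨd : DifferentiableOn ℂ Ψ (ball x₀ (r / 2)) := by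
    have h1 : DifferentiableOn ℂ (fderiv ℂ Φ) (ball x₀ (r / 2)) :=
      hΦ.fderiv.differentiableOn.mono hsub
    exact (ContinuousLinearMap.apply ℂ F w).differentiable.comp_differentiableOn h1
  have hΨB : ∀ y ∈ ball x₀ (r / 2), ‖Ψ y‖ ≤ 4 * B * ‖w‖ / r := by
    intro y hy
    have h := norm_fderiv_apply_le_of_line hΦ.differentiableOn hB (hsub hy) w
    have hgap : r / 2 < r - ‖y - x₀‖ := by
      rw [mem_ball, dist_eq_norm] at hy; linarith
    calc ‖Ψ y‖ ≤ 2 * B * ‖w‖ / (r - ‖y - x₀‖) := h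
      _ ≤ 2 * B * ‖w‖ / (r / 2) := by
          apply div_le_div_of_nonneg_left _ (by positivity) hgap.le
          positivity
      _ = 4 * B * ‖w‖ / r := by
          field_simp; ring
  have hx₀ : x₀ ∈ ball x₀ (r / 2) := mem_ball_self (by positivity)
  have hv : 4 * ‖u - x₀‖ ≤ r / 2 - ‖x₀ - x₀‖ := by
    rw [sub_self, norm_zero, sub_zero]; linarith
  have h := norm_sub_le_of_line hΨd hΨB hx₀ hv
  rw [add_sub_cancel, sub_self, norm_zero, sub_zero] at h
  calc ‖fderiv ℂ Φ u w - fderiv ℂ Φ x₀ w‖ = ‖Ψ u - Ψ x₀‖ := rfl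
    _ ≤ 4 * (4 * B * ‖w‖ / r) * ‖u - x₀‖ / (r / 2) := h
    _ = 32 * B * ‖w‖ * ‖u - x₀‖ / r ^ 2 := by
        field_simp; ring

end Engine

/-! ## §2. Tuples in a Banach algebra: the arithmetic mean and the exponential curve -/

section Tuples

variable {ι : Type*} [Fintype ι] {𝔄 : Type*} [NormedRing 𝔄] [NormedAlgebra ℂ 𝔄]

variable (ι 𝔄) in
/-- The arithmetic mean `W ↦ n⁻¹ Σ_j W_j` of a tuple, as a continuous `ℂ`-linear map
(`n = Fintype.card ι`; for empty `ι` it is `0` by the convention `0⁻¹ = 0`); the right side of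
[B12] (0.8). [folklore] -/
def meanCLM : (ι → 𝔄) →L[ℂ] 𝔄 :=
  (Fintype.card ι : ℂ)⁻¹ • ∑ j : ι, ContinuousLinearMap.proj (R := ℂ) (φ := fun _ : ι => 𝔄) j

/-- Unfolding of `meanCLM`. [folklore] -/
@[simp] theorem meanCLM_apply (W : ι → 𝔄) :
    meanCLM ι 𝔄 W = (Fintype.card ι : ℂ)⁻¹ • ∑ j, W j := by
  simp [meanCLM]

/-- `‖n⁻¹ Σ_j W_j‖ ≤ max_j ‖W_j‖`. [folklore] -/
theorem norm_meanCLM_apply_le (W : ι → 𝔄) : ‖meanCLM ι 𝔄 W‖ ≤ ‖W‖ := by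
  rw [meanCLM_apply]
  rcases isEmpty_or_nonempty ι with hι | hι
  · simp
  have hn : 0 < (Fintype.card ι : ℝ) := Nat.cast_pos.mpr Fintype.card_pos
  calc ‖(Fintype.card ι : ℂ)⁻¹ • ∑ j, W j‖
        ≤ ‖(Fintype.card ι : ℂ)⁻¹‖ * ∑ j, ‖W j‖ := by
          rw [norm_smul]
          gcongr
          exact norm_sum_le _ _
    _ ≤ (Fintype.card ι : ℝ)⁻¹ * ∑ _j : ι, ‖W‖ := by
          rw [norm_inv, Complex.norm_natCast]
          gcongr with j
          exact norm_le_pi_norm W j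
    _ = ‖W‖ := by
          rw [Finset.sum_const, Finset.card_univ, nsmul_eq_mul]
          field_simp

variable [CompleteSpace 𝔄]

/-- `‖exp Y - 1‖ ≤ e^{‖Y‖} - 1` (termwise comparison of the exponential series). [folklore] -/
theorem norm_exp_sub_one_le (Y : 𝔄) : ‖exp Y - 1‖ ≤ Real.exp ‖Y‖ - 1 := by
  set f : ℕ → 𝔄 := fun n => ((n.factorial : ℝ)⁻¹) • Y ^ n with hf
  have hfs : HasSum f (exp Y) := exp_series_hasSum_exp' (𝕂 := ℝ) Y
  have h1 : HasSum (fun n => f (n + 1)) (exp Y - 1) := by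
    have := (hasSum_nat_add_iff' 1).mpr hfs
    simpa [hf, Finset.sum_range_one] using this
  have hg : HasSum (fun n : ℕ => ‖Y‖ ^ (n + 1) / ((n + 1).factorial : ℝ))
      (Real.exp ‖Y‖ - 1) := by
    have hR : HasSum (fun n : ℕ => ‖Y‖ ^ n / (n.factorial : ℝ)) (Real.exp ‖Y‖) := by
      rw [Real.exp_eq_exp_ℝ]
      exact expSeries_div_hasSum_exp ‖Y‖
    have := (hasSum_nat_add_iff' 1).mpr hR
    simpa [Finset.sum_range_one] using this
  refine h1.norm_le_of_bounded hg fun n => ?_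
  rw [hf]
  dsimp only
  rw [norm_smul, norm_inv, Real.norm_natCast, div_eq_inv_mul]
  gcongr
  exact norm_pow_le' _ (Nat.succ_pos n)

/-- `‖exp Y - 1‖ ≤ 2‖Y‖` for `‖Y‖ ≤ 1`. [folklore] -/
theorem norm_exp_sub_one_le_two_mul {Y : 𝔄} (hY : ‖Y‖ ≤ 1) : ‖exp Y - 1‖ ≤ 2 * ‖Y‖ := by
  refine (norm_exp_sub_one_le Y).trans ?_
  have h := Real.abs_exp_sub_one_le (x := ‖Y‖) (by rwa [abs_of_nonneg (norm_nonneg _)])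
  rw [abs_of_nonneg (norm_nonneg _)] at h
  exact (le_abs_self _).trans h

/-- The exponential curve `t ↦ {exp (t X_j)}_j` through the identity tuple (the
parametrisation `U_j = exp iA_j` of [B12] (0.8), `X_j = iA_j`). [folklore] -/
def expCurve (X : ι → 𝔄) (t : ℂ) : ι → 𝔄 := fun j => exp (t • X j)

omit [Fintype ι] [CompleteSpace 𝔄] in
/-- The exponential curve passes through the identity tuple at `t = 0`. [folklore] -/
@[simp] theorem expCurve_zero (X : ι → 𝔄) : expCurve X 0 = 1 := by
  funext j; simp [expCurve]

omit [Fintype ι] [CompleteSpace 𝔄] in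
/-- At `t = 1` the exponential curve is the tuple `{exp X_j}`. [folklore] -/
theorem expCurve_one (X : ι → 𝔄) : expCurve X 1 = fun j => exp (X j) := by
  funext j; simp [expCurve]

omit [Fintype ι] in
/-- Derivative of the exponential curve: `d/dt {exp (t X_j)} = {exp (t X_j) X_j}`. [folklore] -/
theorem hasDerivAt_expCurve (X : ι → 𝔄) (t : ℂ) :
    HasDerivAt (expCurve X) (fun j => exp (t • X j) * X j) t :=
  hasDerivAt_pi.mpr fun j => hasDerivAt_exp_smul_const (X j) t

omit [Fintype ι] in
/-- At `t = 0` the exponential curve has velocity `X`. [folklore] -/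
theorem hasDerivAt_expCurve_zero (X : ι → 𝔄) : HasDerivAt (expCurve X) X 0 := by
  have h := hasDerivAt_expCurve X 0
  simp only [zero_smul, exp_zero, one_mul] at h
  exact h

/-- The exponential curve is an entire map `ℂ → (ι → 𝔄)`. [folklore] -/
theorem differentiable_expCurve (X : ι → 𝔄) : Differentiable ℂ (expCurve X) :=
  fun t => (hasDerivAt_expCurve X t).differentiableAt

/-- For `‖t‖ ‖X‖ < r/2` (and `r ≤ 1`) the exponential curve lies in the polydisc
`ball 1 r`: `‖exp (t X_j) - 1‖ ≤ 2‖t X_j‖ < r`. [folklore] -/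
theorem expCurve_mem_ball {X : ι → 𝔄} {r : ℝ} (hr : 0 < r) (hr1 : r ≤ 1) {t : ℂ}
    (ht : ‖t‖ * ‖X‖ < r / 2) : expCurve X t ∈ ball (1 : ι → 𝔄) r := by
  rw [mem_ball, dist_eq_norm, pi_norm_lt_iff hr]
  intro j
  simp only [Pi.sub_apply, Pi.one_apply, expCurve]
  have h1 : ‖t • X j‖ ≤ ‖t‖ * ‖X‖ := by
    rw [norm_smul]; gcongr; exact norm_le_pi_norm X j
  have h2 : ‖t • X j‖ ≤ 1 := by linarith
  calc ‖exp (t • X j) - 1‖ ≤ 2 * ‖t • X j‖ := norm_exp_sub_one_le_two_mul h2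
    _ < r := by linarith

open MatrixLog

/-- `D(mlog)(1) = id`: the Mercator logarithm has the identity as Fréchet derivative at `1`
(from `exp ∘ mlog = id` near `1`, `D(exp)(0) = id` and uniqueness of the derivative).
[folklore] -/
theorem hasFDerivAt_mlog_one : HasFDerivAt (mlog : 𝔄 → 𝔄) (1 : 𝔄 →L[ℂ] 𝔄) 1 := by
  have hd : DifferentiableAt ℂ (mlog : 𝔄 → 𝔄) 1 :=
    (analyticAt_mlog (by simp)).differentiableAt
  have hD : HasFDerivAt (mlog : 𝔄 → 𝔄) (fderiv ℂ (mlog : 𝔄 → 𝔄) 1) 1 := hd.hasFDerivAt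
  have hexp : HasFDerivAt (exp : 𝔄 → 𝔄) (1 : 𝔄 →L[ℂ] 𝔄) (mlog (1 : 𝔄)) := by
    rw [mlog_one]; exact hasFDerivAt_exp_zero
  have hcomp : HasFDerivAt (fun X : 𝔄 => exp (mlog X))
      ((1 : 𝔄 →L[ℂ] 𝔄).comp (fderiv ℂ (mlog : 𝔄 → 𝔄) 1)) 1 := hexp.comp (1 : 𝔄) hD
  have hev : (id : 𝔄 → 𝔄) =ᶠ[𝓝 (1 : 𝔄)] (fun X : 𝔄 => exp (mlog X)) := by
    filter_upwards [Metric.ball_mem_nhds (1 : 𝔄) zero_lt_one] with X hX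
    rw [mem_ball, dist_eq_norm] at hX
    exact (exp_mlog hX).symm
  have hid : HasFDerivAt (id : 𝔄 → 𝔄)
      ((1 : 𝔄 →L[ℂ] 𝔄).comp (fderiv ℂ (mlog : 𝔄 → 𝔄) 1)) 1 := hcomp.congr_of_eventuallyEq hev
  have huniq := hid.unique (hasFDerivAt_id (1 : 𝔄))
  rw [ContinuousLinearMap.one_def, ContinuousLinearMap.id_comp] at huniq
  rw [huniq] at hD
  rwa [ContinuousLinearMap.one_def]

end Tuples

/-! ## §3. The hypothesis structure: [B12]'s axioms «analytic» + «close to the identity» +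
(0.8) to first order, on the polydisc around the identity tuple -/

section Mean

variable {ι : Type*} [Fintype ι] {𝔄 : Type*} [NormedRing 𝔄] [NormedAlgebra ℂ 𝔄]
  [CompleteSpace 𝔄]

/-- **[B12] p. 253, the analytic part of the axioms (0.5)–(0.9), quantified.**  An abstract
average `M : (ι → 𝔄) → 𝔄` of `ι`-tuples which is analytic on the sup-norm polydisc
`{U : max_j ‖U_j - 1‖ < r}` («we assume that it is an analytic function» on tuples «with
sufficiently small diameters», after the (0.6)-reduction to the identity tuple), stays within
`K ≤ 1/2` of the identity there («the average is close to the identity also»), and satisfies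
(0.8) to zeroth and first order: `M(1) = 1` and `DM(1) =` the arithmetic mean.  The radius is
normalised to `0 < r ≤ 1`.  (The algebraic axioms (0.5)–(0.7), (0.9) are not needed for the
estimates of this file and are not part of the structure.)  This is a HYPOTHESIS structure: the
file never asserts it of a particular average. [cite: Balaban1987RG1, (0.5)–(0.9) p.253] -/
structure IsAnalyticMean (M : (ι → 𝔄) → 𝔄) (r K : ℝ) : Prop where
  r_pos : 0 < r
  r_le_one : r ≤ 1
  K_le_half : K ≤ 1 / 2
  analyticOnNhd : AnalyticOnNhd ℂ M (ball (1 : ι → 𝔄) r)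
  norm_sub_one_le : ∀ U ∈ ball (1 : ι → 𝔄) r, ‖M U - 1‖ ≤ K
  map_one : M 1 = 1
  hasFDerivAt_one : HasFDerivAt M (meanCLM ι 𝔄) 1

open MatrixLog

/-- **The literal (0.8) gives the two first-order fields.**  If `M` is analytic on the polydisc
`ball 1 r` (`0 < r ≤ 1`), stays within `K ≤ 1/2` of `1` there, and satisfies (0.8) in the
literal form «`mlog (M {exp A_j}) - n⁻¹ Σ_j A_j` is of higher order (= `o(max_j ‖A_j‖)`) at
`A = 0`», then `M(1) = 1`, `DM(1) =` the arithmetic mean, i.e. `IsAnalyticMean M r K`.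
(Chain rule: `A ↦ {exp A_j}` has derivative `id` at `0`, `mlog` has derivative `id` at `1`,
and `M = exp ∘ mlog ∘ M` near the identity tuple.) [folklore] -/
theorem IsAnalyticMean.of_littleO {M : (ι → 𝔄) → 𝔄} {r K : ℝ} (hr : 0 < r) (hr1 : r ≤ 1)
    (hK : K ≤ 1 / 2) (han : AnalyticOnNhd ℂ M (ball (1 : ι → 𝔄) r))
    (hbd : ∀ U ∈ ball (1 : ι → 𝔄) r, ‖M U - 1‖ ≤ K)
    (h08 : (fun A : ι → 𝔄 => mlog (M (fun j => exp (A j))) - meanCLM ι 𝔄 A)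
      =o[𝓝 (0 : ι → 𝔄)] (fun A => A)) :
    IsAnalyticMean M r K := by
  have hM_lt : ∀ U ∈ ball (1 : ι → 𝔄) r, ‖M U - 1‖ < 1 :=
    fun U hU => (hbd U hU).trans_lt (by linarith)
  have h1mem : (1 : ι → 𝔄) ∈ ball (1 : ι → 𝔄) r := mem_ball_self hr
  -- Step 1: `M 1 = 1` (the value of the little-o function at `0` vanishes).
  have hΦ1 : mlog (M 1) = 0 := by
    have h0 := (h08.def zero_lt_one).self_of_nhds
    simp only [Pi.zero_apply, exp_zero, map_zero, sub_zero, norm_zero, mul_zero,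
      norm_le_zero_iff] at h0
    exact h0
  have hM1 : M 1 = 1 := by
    rw [← exp_mlog (hM_lt 1 h1mem), hΦ1, exp_zero]
  have hM1' : M (fun _ : ι => (1 : 𝔄)) = 1 := hM1
  -- Step 2: `A ↦ {exp A_j}` has derivative `id` at `0`.
  have he : HasFDerivAt (fun (A : ι → 𝔄) (j : ι) => exp (A j))
      (ContinuousLinearMap.id ℂ (ι → 𝔄)) 0 := by
    apply hasFDerivAt_pi''
    intro j
    rw [ContinuousLinearMap.comp_id]
    have hp : HasFDerivAt (fun A : ι → 𝔄 => A j) (ContinuousLinearMap.proj j) (0 : ι → 𝔄) :=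
      (ContinuousLinearMap.proj (R := ℂ) (φ := fun _ : ι => 𝔄) j).hasFDerivAt
    have hexp : HasFDerivAt (exp : 𝔄 → 𝔄) (1 : 𝔄 →L[ℂ] 𝔄) ((fun A : ι → 𝔄 => A j) 0) :=
      hasFDerivAt_exp_zero
    have hc := hexp.comp (0 : ι → 𝔄) hp
    rw [ContinuousLinearMap.one_def, ContinuousLinearMap.id_comp] at hc
    exact hc
  have he0 : (fun j : ι => exp ((0 : ι → 𝔄) j)) = 1 := by funext j; simp
  -- Step 3: the literal (0.8) says `A ↦ mlog (M {exp A_j})` has derivative the mean at `0`.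
  have hΦe : HasFDerivAt (fun A : ι → 𝔄 => mlog (M (fun j => exp (A j)))) (meanCLM ι 𝔄) 0 := by
    rw [hasFDerivAt_iff_isLittleO_nhds_zero]
    refine h08.congr_left fun A => ?_
    simp only [zero_add, Pi.zero_apply, exp_zero, hM1', mlog_one, sub_zero]
  -- Step 4: `mlog ∘ M` is differentiable at `1`, hence its derivative there is the mean.
  have hΦd : DifferentiableAt ℂ (fun U => mlog (M U)) (1 : ι → 𝔄) :=
    ((analyticAt_mlog (hM_lt 1 h1mem)).comp (han 1 h1mem)).differentiableAt
  have hΦD : HasFDerivAt (fun U => mlog (M U)) (meanCLM ι 𝔄) (1 : ι → 𝔄) := by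
    have hD : HasFDerivAt (fun U => mlog (M U)) (fderiv ℂ (fun U => mlog (M U)) (1 : ι → 𝔄))
        ((fun (A : ι → 𝔄) (j : ι) => exp (A j)) 0) := by
      have he0' : (fun (A : ι → 𝔄) (j : ι) => exp (A j)) 0 = 1 := he0
      rw [he0']; exact hΦd.hasFDerivAt
    have hcomp := hD.comp (0 : ι → 𝔄) he
    rw [ContinuousLinearMap.comp_id] at hcomp
    have huniq : fderiv ℂ (fun U => mlog (M U)) 1 = meanCLM ι 𝔄 := hcomp.unique hΦe
    rw [← huniq]; exact hΦd.hasFDerivAt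
  -- Step 5: `M = exp ∘ (mlog ∘ M)` near `1`, and `D exp (0) = id`.
  have hMD : HasFDerivAt M (meanCLM ι 𝔄) 1 := by
    have hexp : HasFDerivAt (exp : 𝔄 → 𝔄) (1 : 𝔄 →L[ℂ] 𝔄) (mlog (M (1 : ι → 𝔄))) := by
      rw [hΦ1]; exact hasFDerivAt_exp_zero
    have hcomp := hexp.comp (1 : ι → 𝔄) hΦD
    rw [ContinuousLinearMap.one_def, ContinuousLinearMap.id_comp] at hcomp
    refine hcomp.congr_of_eventuallyEq ?_
    filter_upwards [isOpen_ball.mem_nhds h1mem] with U hU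
    exact (exp_mlog (hM_lt U hU)).symm
  exact ⟨hr, hr1, hK, han, hbd, hM1, hMD⟩

namespace IsAnalyticMean

variable {M : (ι → 𝔄) → 𝔄} {r K : ℝ} (h : IsAnalyticMean M r K)
include h

omit [CompleteSpace 𝔄] in
/-- `M` is `ℂ`-differentiable on the polydisc. [folklore] -/
theorem differentiableOn : DifferentiableOn ℂ M (ball (1 : ι → 𝔄) r) :=
  h.analyticOnNhd.differentiableOn

omit [CompleteSpace 𝔄] in
/-- `DM(1) =` the arithmetic mean, as an equation for `fderiv`. [folklore] -/
theorem fderiv_one : fderiv ℂ M 1 = meanCLM ι 𝔄 := h.hasFDerivAt_one.fderiv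

omit [CompleteSpace 𝔄] in
/-- The shifted map `U ↦ M U - 1` (bounded by `K` on the polydisc) is differentiable there.
[folklore] -/
theorem differentiableOn_sub_one : DifferentiableOn ℂ (fun U => M U - 1) (ball (1 : ι → 𝔄) r) :=
  h.differentiableOn.sub_const 1

omit [CompleteSpace 𝔄] in
/-- The shifted map `U ↦ M U - 1` is analytic on the polydisc. [folklore] -/
theorem analyticOnNhd_sub_one : AnalyticOnNhd ℂ (fun U => M U - 1) (ball (1 : ι → 𝔄) r) :=
  h.analyticOnNhd.sub analyticOnNhd_const

omit [CompleteSpace 𝔄] h in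
/-- The shift by the constant `1` does not change the derivative. [folklore] -/
theorem fderiv_sub_one (U : ι → 𝔄) : fderiv ℂ (fun U => M U - 1) U = fderiv ℂ M U :=
  fderiv_sub_const 1

/-- **(0.8″), Lipschitz part.**  `‖M(U + V) - M(U)‖ ≤ 4K‖V‖/(r - ‖U - 1‖)` for `U` in the
polydisc and `4‖V‖ ≤ r - ‖U - 1‖`. [folklore] -/
theorem norm_sub_le {U V : ι → 𝔄} (hU : U ∈ ball (1 : ι → 𝔄) r)
    (hV : 4 * ‖V‖ ≤ r - ‖U - 1‖) :
    ‖M (U + V) - M U‖ ≤ 4 * K * ‖V‖ / (r - ‖U - 1‖) := by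
  have h1 := norm_sub_le_of_line h.differentiableOn_sub_one h.norm_sub_one_le hU hV
  simpa only [sub_sub_sub_cancel_right] using h1

/-- **(0.8″), Lipschitz constant `L_M = 8K/r`** on `{‖U - 1‖ ≤ r/2}` for increments
`‖V‖ ≤ r/8`. [folklore] -/
theorem norm_sub_le_near_one {U V : ι → 𝔄} (hU : ‖U - 1‖ ≤ r / 2) (hV : ‖V‖ ≤ r / 8) :
    ‖M (U + V) - M U‖ ≤ 8 * K / r * ‖V‖ := by
  have hr := h.r_pos
  have hK : 0 ≤ K := by
    have h0 := h.norm_sub_one_le 1 (mem_ball_self h.r_pos)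
    rwa [h.map_one, sub_self, norm_zero] at h0
  have hUb : U ∈ ball (1 : ι → 𝔄) r := by
    rw [mem_ball, dist_eq_norm]; linarith
  have hV' : 4 * ‖V‖ ≤ r - ‖U - 1‖ := by linarith
  have h1 := h.norm_sub_le hUb hV'
  have hgap : r / 2 ≤ r - ‖U - 1‖ := by linarith
  calc ‖M (U + V) - M U‖ ≤ 4 * K * ‖V‖ / (r - ‖U - 1‖) := h1
    _ ≤ 4 * K * ‖V‖ / (r / 2) := by
        apply div_le_div_of_nonneg_left _ (by positivity) hgap
        positivity
    _ = 8 * K / r * ‖V‖ := by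
        field_simp; ring

/-- **Derivative bound.**  `‖DM(U) W‖ ≤ 2K‖W‖/(r - ‖U - 1‖)` on the polydisc. [folklore] -/
theorem norm_fderiv_apply_le {U : ι → 𝔄} (hU : U ∈ ball (1 : ι → 𝔄) r) (W : ι → 𝔄) :
    ‖fderiv ℂ M U W‖ ≤ 2 * K * ‖W‖ / (r - ‖U - 1‖) := by
  have h1 := norm_fderiv_apply_le_of_line h.differentiableOn_sub_one h.norm_sub_one_le hU W
  rwa [fderiv_sub_one (M := M)] at h1

/-- Derivative bound `‖DM(U) W‖ ≤ 4K‖W‖/r` for `‖U - 1‖ ≤ r/2`. [folklore] -/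
theorem norm_fderiv_apply_le_near_one {U : ι → 𝔄} (hU : ‖U - 1‖ ≤ r / 2) (W : ι → 𝔄) :
    ‖fderiv ℂ M U W‖ ≤ 4 * K / r * ‖W‖ := by
  have hr := h.r_pos
  have hK : 0 ≤ K := by
    have h0 := h.norm_sub_one_le 1 (mem_ball_self h.r_pos)
    rwa [h.map_one, sub_self, norm_zero] at h0
  have hUb : U ∈ ball (1 : ι → 𝔄) r := by
    rw [mem_ball, dist_eq_norm]; linarith
  have h1 := h.norm_fderiv_apply_le hUb W
  have hgap : r / 2 ≤ r - ‖U - 1‖ := by linarith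
  calc ‖fderiv ℂ M U W‖ ≤ 2 * K * ‖W‖ / (r - ‖U - 1‖) := h1
    _ ≤ 2 * K * ‖W‖ / (r / 2) := by
        apply div_le_div_of_nonneg_left _ (by positivity) hgap
        positivity
    _ = 4 * K / r * ‖W‖ := by
        field_simp; ring

/-- **(0.8″), derivative part = census (U5).**  `‖DM(U) W - n⁻¹ Σ_j W_j‖ ≤ 32K‖W‖‖U - 1‖/r²`
for `‖U - 1‖ ≤ r/8`: the derivative of the average at a near-identity tuple is the arithmetic
mean up to `O_M(max_j ‖U_j - 1‖)·max_j ‖W_j‖`, with `C′_M = 32K/r²`. [folklore] -/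
theorem norm_fderiv_sub_mean_le {U : ι → 𝔄} (hU : ‖U - 1‖ ≤ r / 8) (W : ι → 𝔄) :
    ‖fderiv ℂ M U W - meanCLM ι 𝔄 W‖ ≤ 32 * K * ‖W‖ * ‖U - 1‖ / r ^ 2 := by
  have h1 := norm_fderiv_sub_fderiv_le h.r_pos h.analyticOnNhd_sub_one h.norm_sub_one_le hU W
  rwa [fderiv_sub_one (M := M), fderiv_sub_one (M := M), h.fderiv_one] at h1

/-- **Second-order Taylor remainder at any tuple of the polydisc.**
`‖M(U + V) - M(U) - DM(U) V‖ ≤ 8K‖V‖²/(r - ‖U - 1‖)²` for `4‖V‖ ≤ r - ‖U - 1‖`. [folklore] -/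
theorem norm_sub_sub_fderiv_le {U V : ι → 𝔄} (hU : U ∈ ball (1 : ι → 𝔄) r)
    (hV : 4 * ‖V‖ ≤ r - ‖U - 1‖) :
    ‖M (U + V) - M U - fderiv ℂ M U V‖ ≤ 8 * K * ‖V‖ ^ 2 / (r - ‖U - 1‖) ^ 2 := by
  have h1 := norm_sub_sub_fderiv_le_of_line h.differentiableOn_sub_one h.norm_sub_one_le hU hV
  rw [fderiv_sub_one (M := M)] at h1
  simpa only [sub_sub_sub_cancel_right] using h1

/-- **(0.8′) at the group level.**  `‖M(1 + V) - 1 - n⁻¹ Σ_j V_j‖ ≤ 8K‖V‖²/r²` for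
`‖V‖ ≤ r/4`. [folklore] -/
theorem norm_sub_one_sub_mean_le {V : ι → 𝔄} (hV : ‖V‖ ≤ r / 4) :
    ‖M (1 + V) - 1 - meanCLM ι 𝔄 V‖ ≤ 8 * K * ‖V‖ ^ 2 / r ^ 2 := by
  have h1 := h.norm_sub_sub_fderiv_le (U := 1) (V := V) (mem_ball_self h.r_pos)
    (by rw [sub_self, norm_zero, sub_zero]; linarith)
  rw [h.map_one, h.fderiv_one, sub_self, norm_zero, sub_zero] at h1
  exact h1

/-- The curve `t ↦ {exp (t X_j)}` stays in the polydisc for `‖t‖ < r/(2‖X‖)`. [folklore] -/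
theorem mapsTo_expCurve {X : ι → 𝔄} (hX : 0 < ‖X‖) :
    MapsTo (expCurve X) (ball (0 : ℂ) (r / (2 * ‖X‖))) (ball (1 : ι → 𝔄) r) := by
  intro t ht
  rw [mem_ball_zero_iff] at ht
  apply expCurve_mem_ball h.r_pos h.r_le_one
  have := (lt_div_iff₀ (by positivity : (0 : ℝ) < 2 * ‖X‖)).mp ht
  linarith

/-- **(0.8′) at the group level, exponential parametrisation.**
`‖M({exp X_j}) - 1 - n⁻¹ Σ_j X_j‖ ≤ 32K‖X‖²/r²` for `‖X‖ = max_j ‖X_j‖ ≤ r/8`. [folklore] -/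
theorem norm_exp_sub_one_sub_mean_le {X : ι → 𝔄} (hX : ‖X‖ ≤ r / 8) :
    ‖M (fun j => exp (X j)) - 1 - meanCLM ι 𝔄 X‖ ≤ 32 * K * ‖X‖ ^ 2 / r ^ 2 := by
  have hr := h.r_pos
  have hK : 0 ≤ K := by
    have h0 := h.norm_sub_one_le 1 (mem_ball_self h.r_pos)
    rwa [h.map_one, sub_self, norm_zero] at h0
  by_cases hX0 : X = 0
  · subst hX0
    have : (fun j : ι => exp ((0 : ι → 𝔄) j)) = 1 := by funext j; simp
    rw [this, h.map_one]; simp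
  have hXpos : 0 < ‖X‖ := norm_pos_iff.mpr hX0
  set R : ℝ := r / (2 * ‖X‖) with hR
  have hR4 : 4 ≤ R := by
    rw [hR, le_div_iff₀ (by positivity)]; linarith
  have h1 := norm_sub_sub_fderiv_le_of_curve h.differentiableOn_sub_one h.norm_sub_one_le hR4
    (differentiable_expCurve X).differentiableOn (h.mapsTo_expCurve hXpos) (expCurve_zero X)
    (hasDerivAt_expCurve_zero X)
  rw [fderiv_sub_one (M := M), h.fderiv_one, h.map_one, expCurve_one, sub_self, sub_zero] at h1
  calc ‖M (fun j => exp (X j)) - 1 - meanCLM ι 𝔄 X‖ ≤ 8 * K / R ^ 2 := h1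
    _ = 32 * K * ‖X‖ ^ 2 / r ^ 2 := by
        rw [hR]; field_simp; ring

/-- `mlog ∘ M` is analytic on the polydisc (`‖M U - 1‖ ≤ K ≤ 1/2 < 1`). [folklore] -/
theorem analyticOnNhd_mlog_comp : AnalyticOnNhd ℂ (fun U => mlog (M U)) (ball (1 : ι → 𝔄) r) := by
  intro U hU
  have hMU : ‖M U - 1‖ < 1 := by
    have := h.norm_sub_one_le U hU; have := h.K_le_half; linarith
  exact (analyticAt_mlog hMU).comp (h.analyticOnNhd U hU)

/-- `mlog ∘ M` is differentiable on the polydisc. [folklore] -/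
theorem differentiableOn_mlog_comp :
    DifferentiableOn ℂ (fun U => mlog (M U)) (ball (1 : ι → 𝔄) r) :=
  h.analyticOnNhd_mlog_comp.differentiableOn

/-- `‖mlog (M U)‖ ≤ 2K` on the polydisc. [folklore] -/
theorem norm_mlog_comp_le : ∀ U ∈ ball (1 : ι → 𝔄) r, ‖mlog (M U)‖ ≤ 2 * K := by
  intro U hU
  have h1 := h.norm_sub_one_le U hU
  have h2 : ‖M U - 1‖ ≤ 1 / 2 := h1.trans h.K_le_half
  exact (norm_mlog_le_two_mul h2).trans (by linarith)

/-- `D(mlog ∘ M)(1) =` the arithmetic mean. [folklore] -/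
theorem hasFDerivAt_mlog_comp_one : HasFDerivAt (fun U => mlog (M U)) (meanCLM ι 𝔄) 1 := by
  have h1 : HasFDerivAt (mlog : 𝔄 → 𝔄) (1 : 𝔄 →L[ℂ] 𝔄) (M 1) := by
    rw [h.map_one]; exact hasFDerivAt_mlog_one
  have h2 := h1.comp (1 : ι → 𝔄) h.hasFDerivAt_one
  rwa [ContinuousLinearMap.one_def, ContinuousLinearMap.id_comp] at h2

/-- `D(mlog ∘ M)(1) =` the arithmetic mean, as an equation for `fderiv`. [folklore] -/
theorem fderiv_mlog_comp_one : fderiv ℂ (fun U => mlog (M U)) 1 = meanCLM ι 𝔄 :=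
  h.hasFDerivAt_mlog_comp_one.fderiv

/-- **(0.8′) = census (U4), in the printed exp/log form.**
`‖mlog (M {exp X_j}) - n⁻¹ Σ_j X_j‖ ≤ 64K‖X‖²/r²` for `‖X‖ = max_j ‖X_j‖ ≤ r/8`; i.e.
`r_M = r/8` and `C_M = 64K/r²` in «(1/i) log M({exp iA_j}) = (1/n) Σ A_j + O_M((max|A_j|)²)»
(with `X_j = iA_j`). [folklore] -/
theorem norm_mlog_exp_sub_mean_le {X : ι → 𝔄} (hX : ‖X‖ ≤ r / 8) :
    ‖mlog (M (fun j => exp (X j))) - meanCLM ι 𝔄 X‖ ≤ 64 * K * ‖X‖ ^ 2 / r ^ 2 := by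
  have hr := h.r_pos
  have hK : 0 ≤ K := by
    have h0 := h.norm_sub_one_le 1 (mem_ball_self h.r_pos)
    rwa [h.map_one, sub_self, norm_zero] at h0
  by_cases hX0 : X = 0
  · subst hX0
    have : (fun j : ι => exp ((0 : ι → 𝔄) j)) = 1 := by funext j; simp
    rw [this, h.map_one]; simp
  have hXpos : 0 < ‖X‖ := norm_pos_iff.mpr hX0
  set R : ℝ := r / (2 * ‖X‖) with hR
  have hR4 : 4 ≤ R := by
    rw [hR, le_div_iff₀ (by positivity)]; linarith
  have h1 := norm_sub_sub_fderiv_le_of_curve h.differentiableOn_mlog_comp h.norm_mlog_comp_le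
    hR4 (differentiable_expCurve X).differentiableOn (h.mapsTo_expCurve hXpos) (expCurve_zero X)
    (hasDerivAt_expCurve_zero X)
  rw [h.fderiv_mlog_comp_one, h.map_one, mlog_one, expCurve_one, sub_zero] at h1
  calc ‖mlog (M (fun j => exp (X j))) - meanCLM ι 𝔄 X‖ ≤ 8 * (2 * K) / R ^ 2 := h1
    _ = 64 * K * ‖X‖ ^ 2 / r ^ 2 := by
        rw [hR]; field_simp; ring

/-- **(U5) in log form.**  `‖D(mlog ∘ M)(U) W - n⁻¹ Σ_j W_j‖ ≤ 64K‖W‖‖U - 1‖/r²` for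
`‖U - 1‖ ≤ r/8`. [folklore] -/
theorem norm_fderiv_mlog_sub_mean_le {U : ι → 𝔄} (hU : ‖U - 1‖ ≤ r / 8) (W : ι → 𝔄) :
    ‖fderiv ℂ (fun U => mlog (M U)) U W - meanCLM ι 𝔄 W‖
      ≤ 64 * K * ‖W‖ * ‖U - 1‖ / r ^ 2 := by
  have h1 := norm_fderiv_sub_fderiv_le h.r_pos h.analyticOnNhd_mlog_comp h.norm_mlog_comp_le hU W
  rw [h.fderiv_mlog_comp_one] at h1
  calc ‖fderiv ℂ (fun U => mlog (M U)) U W - meanCLM ι 𝔄 W‖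
        ≤ 32 * (2 * K) * ‖W‖ * ‖U - 1‖ / r ^ 2 := h1
    _ = 64 * K * ‖W‖ * ‖U - 1‖ / r ^ 2 := by ring

end IsAnalyticMean

/-! ## §4. Consumer forms for the [B7] transfer (v1.1, append-only): (0.8′) for a near-identity
tuple of group elements ((47′) of the census), the second-order remainder of `mlog ∘ M` at any
tuple, and (U5) in the census's use-form «log M({e^{a_j} Z_j}) vs log M({Z_j})» -/

/-- `‖exp Y - 1 - Y‖ ≤ e^{‖Y‖} - 1 - ‖Y‖` (termwise comparison of the exponential series over
`ℝ`; no `NormedAlgebra ℚ` / `NormOneClass` hypothesis).  The consequence `≤ ‖Y‖²` for `‖Y‖ ≤ 1`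
(`Real.abs_exp_sub_one_sub_id_le`) is the tree's `Literature.Analysis.Complex.norm_exp_sub_one_sub_le`
(`RungeBoxes`, not imported here to keep the import list short); it is used inline below.
[folklore] -/
theorem norm_exp_sub_one_sub_self_le (Y : 𝔄) :
    ‖exp Y - 1 - Y‖ ≤ Real.exp ‖Y‖ - 1 - ‖Y‖ := by
  set f : ℕ → 𝔄 := fun n => ((n.factorial : ℝ)⁻¹) • Y ^ n with hf
  have hfs : HasSum f (exp Y) := exp_series_hasSum_exp' (𝕂 := ℝ) Y
  have h1 : HasSum (fun n => f (n + 2)) (exp Y - 1 - Y) := by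
    have := (hasSum_nat_add_iff' 2).mpr hfs
    simpa [hf, Finset.sum_range_succ, sub_sub] using this
  have hg : HasSum (fun n : ℕ => ‖Y‖ ^ (n + 2) / ((n + 2).factorial : ℝ))
      (Real.exp ‖Y‖ - 1 - ‖Y‖) := by
    have hR : HasSum (fun n : ℕ => ‖Y‖ ^ n / (n.factorial : ℝ)) (Real.exp ‖Y‖) := by
      rw [Real.exp_eq_exp_ℝ]
      exact expSeries_div_hasSum_exp ‖Y‖
    have := (hasSum_nat_add_iff' 2).mpr hR
    simpa [Finset.sum_range_succ, sub_sub] using this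
  refine h1.norm_le_of_bounded hg fun n => ?_
  rw [hf]
  dsimp only
  rw [norm_smul, norm_inv, Real.norm_natCast, div_eq_inv_mul]
  gcongr
  exact norm_pow_le' _ (by omega)

namespace IsAnalyticMean

variable {M : (ι → 𝔄) → 𝔄} {r K : ℝ} (h : IsAnalyticMean M r K)
include h

/-- **Second-order Taylor remainder of `mlog ∘ M` at any tuple of the polydisc.**
`‖mlog M(U + V) - mlog M(U) - D(mlog ∘ M)(U) V‖ ≤ 16K‖V‖²/(r - ‖U - 1‖)²` for
`4‖V‖ ≤ r - ‖U - 1‖`. [folklore] -/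
theorem norm_mlog_comp_sub_sub_fderiv_le {U V : ι → 𝔄} (hU : U ∈ ball (1 : ι → 𝔄) r)
    (hV : 4 * ‖V‖ ≤ r - ‖U - 1‖) :
    ‖mlog (M (U + V)) - mlog (M U) - fderiv ℂ (fun U => mlog (M U)) U V‖
      ≤ 16 * K * ‖V‖ ^ 2 / (r - ‖U - 1‖) ^ 2 := by
  have h1 := norm_sub_sub_fderiv_le_of_line h.differentiableOn_mlog_comp h.norm_mlog_comp_le hU hV
  calc ‖mlog (M (U + V)) - mlog (M U) - fderiv ℂ (fun U => mlog (M U)) U V‖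
        ≤ 8 * (2 * K) * ‖V‖ ^ 2 / (r - ‖U - 1‖) ^ 2 := h1
    _ = 16 * K * ‖V‖ ^ 2 / (r - ‖U - 1‖) ^ 2 := by ring

/-- **(0.8′) for a near-identity tuple of GROUP elements** (the form consumed at [B7] (47):
`A_j := (1/i) log U_j`): `‖mlog (M U) - n⁻¹ Σ_j mlog U_j‖ ≤ 256K‖U - 1‖²/r²` for
`‖U - 1‖ = max_j ‖U_j - 1‖ ≤ r/16` (from `norm_mlog_exp_sub_mean_le` with `X_j = mlog U_j`,
`exp X_j = U_j`, `‖X_j‖ ≤ 2‖U_j - 1‖`). [folklore] -/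
theorem norm_mlog_sub_mean_mlog_le {U : ι → 𝔄} (hU : ‖U - 1‖ ≤ r / 16) :
    ‖mlog (M U) - meanCLM ι 𝔄 (fun j => mlog (U j))‖ ≤ 256 * K * ‖U - 1‖ ^ 2 / r ^ 2 := by
  have hr := h.r_pos
  have hr1 := h.r_le_one
  have hK : 0 ≤ K := by
    have h0 := h.norm_sub_one_le 1 (mem_ball_self h.r_pos)
    rwa [h.map_one, sub_self, norm_zero] at h0
  set X : ι → 𝔄 := fun j => mlog (U j) with hX
  have hUj : ∀ j, ‖U j - 1‖ ≤ ‖U - 1‖ := fun j => by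
    have hj := norm_le_pi_norm (U - 1) j
    rwa [show (U - 1) j = U j - 1 from rfl] at hj
  have hXle : ‖X‖ ≤ 2 * ‖U - 1‖ := by
    refine (pi_norm_le_iff_of_nonneg (by positivity)).mpr fun j => ?_
    have hj : ‖U j - 1‖ ≤ 1 / 2 := by linarith [hUj j]
    exact (norm_mlog_le_two_mul hj).trans (by linarith [hUj j])
  have hXr : ‖X‖ ≤ r / 8 := by linarith
  have hexp : (fun j => exp (X j)) = U := by
    funext j
    exact exp_mlog (by linarith [hUj j])
  have h1 := h.norm_mlog_exp_sub_mean_le hXr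
  rw [hexp] at h1
  calc ‖mlog (M U) - meanCLM ι 𝔄 X‖ ≤ 64 * K * ‖X‖ ^ 2 / r ^ 2 := h1
    _ ≤ 64 * K * (2 * ‖U - 1‖) ^ 2 / r ^ 2 := by gcongr
    _ = 256 * K * ‖U - 1‖ ^ 2 / r ^ 2 := by ring

/-- **(U5) in the use-form of the transfer census** ([B7] Prop. 3 / (162) / Sect. F–G one-step
expansions): for a near-identity tuple `Z` (`‖Z - 1‖ ≤ r/8`) and small Lie-algebra increments
`a` (`‖a‖ = max_j ‖a_j‖ ≤ r/16`),
`‖mlog M({exp(a_j) Z_j}) - mlog M({Z_j}) - n⁻¹ Σ_j a_j‖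
   ≤ (2 + 192K/r²) ‖a‖ ‖Z - 1‖ + (1 + 192K/r²) ‖a‖²`,
i.e. `log M({e^{a_j}Z_j}) - log M({Z_j}) = n⁻¹ Σ a_j + O_M(ρ · max‖a_j‖) + O_M((max‖a_j‖)²)` with
both `O_M` constants explicit.  (Assembled from `norm_mlog_comp_sub_sub_fderiv_le` at `Z`,
`norm_fderiv_mlog_sub_mean_le`, and `‖(e^{a_j} - 1)Z_j - a_j‖ ≤ ‖a_j‖² + 2‖a_j‖‖Z_j - 1‖`.  The
census writes the left side with `log [M({e^{a_j}Z_j}) M({Z_j})⁻¹]`; the two differ by the same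
two `O_M`-types of terms — consumer's algebra with (26).) [folklore] -/
theorem norm_mlog_expMul_sub_mlog_sub_mean_le {Z a : ι → 𝔄} (hZ : ‖Z - 1‖ ≤ r / 8)
    (ha : ‖a‖ ≤ r / 16) :
    ‖mlog (M (fun j => exp (a j) * Z j)) - mlog (M Z) - meanCLM ι 𝔄 a‖
      ≤ (2 + 192 * K / r ^ 2) * ‖a‖ * ‖Z - 1‖ + (1 + 192 * K / r ^ 2) * ‖a‖ ^ 2 := by
  have hr := h.r_pos
  have hr1 := h.r_le_one
  have hK : 0 ≤ K := by
    have h0 := h.norm_sub_one_le 1 (mem_ball_self h.r_pos)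
    rwa [h.map_one, sub_self, norm_zero] at h0
  have hρ0 : 0 ≤ ‖Z - 1‖ := norm_nonneg _
  have ha0 : 0 ≤ ‖a‖ := norm_nonneg _
  -- the increment `V_j = e^{a_j} Z_j - Z_j = (e^{a_j} - 1) + (e^{a_j} - 1)(Z_j - 1)`
  set V : ι → 𝔄 := (fun j => exp (a j) * Z j) - Z with hV
  have hZV : Z + V = fun j => exp (a j) * Z j := by rw [hV, add_sub_cancel]
  have haj : ∀ j, ‖a j‖ ≤ ‖a‖ := fun j => norm_le_pi_norm a j
  have hZj : ∀ j, ‖Z j - 1‖ ≤ ‖Z - 1‖ := fun j => by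
    have hj := norm_le_pi_norm (Z - 1) j
    rwa [show (Z - 1) j = Z j - 1 from rfl] at hj
  have he1 : ∀ j, ‖exp (a j) - 1‖ ≤ 2 * ‖a‖ := fun j =>
    (norm_exp_sub_one_le_two_mul (by linarith [haj j])).trans (by linarith [haj j])
  have hVj : ∀ j, V j = (exp (a j) - 1) + (exp (a j) - 1) * (Z j - 1) := by
    intro j
    simp only [hV, Pi.sub_apply]
    noncomm_ring
  have hVn : ‖V‖ ≤ 3 * ‖a‖ := by
    refine (pi_norm_le_iff_of_nonneg (by positivity)).mpr fun j => ?_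
    rw [hVj j]
    calc ‖(exp (a j) - 1) + (exp (a j) - 1) * (Z j - 1)‖
          ≤ ‖exp (a j) - 1‖ + ‖exp (a j) - 1‖ * ‖Z j - 1‖ :=
            (norm_add_le _ _).trans (by gcongr; exact norm_mul_le _ _)
      _ ≤ 2 * ‖a‖ + 2 * ‖a‖ * ‖Z - 1‖ := by
            gcongr
            · exact he1 j
            · exact he1 j
            · exact hZj j
      _ ≤ 3 * ‖a‖ := by nlinarith
  have hVa : ‖V - a‖ ≤ ‖a‖ ^ 2 + 2 * ‖a‖ * ‖Z - 1‖ := by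
    refine (pi_norm_le_iff_of_nonneg (by positivity)).mpr fun j => ?_
    have hja : ‖a j‖ ≤ 1 := by linarith [haj j]
    have : (V - a) j = (exp (a j) - 1 - a j) + (exp (a j) - 1) * (Z j - 1) := by
      simp only [Pi.sub_apply, hVj j]
      noncomm_ring
    rw [this]
    calc ‖(exp (a j) - 1 - a j) + (exp (a j) - 1) * (Z j - 1)‖
          ≤ ‖exp (a j) - 1 - a j‖ + ‖exp (a j) - 1‖ * ‖Z j - 1‖ :=
            (norm_add_le _ _).trans (by gcongr; exact norm_mul_le _ _)
      _ ≤ ‖a j‖ ^ 2 + 2 * ‖a‖ * ‖Z - 1‖ := by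
            gcongr
            · exact (norm_exp_sub_one_sub_self_le _).trans ((le_abs_self _).trans
                (Real.abs_exp_sub_one_sub_id_le (by rwa [abs_of_nonneg (norm_nonneg _)])))
            · exact he1 j
            · exact hZj j
      _ ≤ ‖a‖ ^ 2 + 2 * ‖a‖ * ‖Z - 1‖ := by
            gcongr
            exact haj j
  -- the three pieces
  have hZball : Z ∈ ball (1 : ι → 𝔄) r := by
    rw [mem_ball, dist_eq_norm]; linarith
  have hV4 : 4 * ‖V‖ ≤ r - ‖Z - 1‖ := by linarith
  have hT1 := h.norm_mlog_comp_sub_sub_fderiv_le hZball hV4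
  have hT2 := h.norm_fderiv_mlog_sub_mean_le hZ V
  have hT3 : ‖meanCLM ι 𝔄 V - meanCLM ι 𝔄 a‖ ≤ ‖a‖ ^ 2 + 2 * ‖a‖ * ‖Z - 1‖ := by
    rw [← map_sub]
    exact (norm_meanCLM_apply_le _).trans hVa
  -- numerical simplification of the first two pieces
  have hT1' : ‖mlog (M (Z + V)) - mlog (M Z) - fderiv ℂ (fun U => mlog (M U)) Z V‖
      ≤ 192 * K * ‖a‖ ^ 2 / r ^ 2 := by
    have hden : (7 * r / 8) ^ 2 ≤ (r - ‖Z - 1‖) ^ 2 := by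
      have h7 : 7 * r / 8 ≤ r - ‖Z - 1‖ := by linarith
      gcongr
    calc ‖mlog (M (Z + V)) - mlog (M Z) - fderiv ℂ (fun U => mlog (M U)) Z V‖
          ≤ 16 * K * ‖V‖ ^ 2 / (r - ‖Z - 1‖) ^ 2 := hT1
      _ ≤ 16 * K * (3 * ‖a‖) ^ 2 / (r - ‖Z - 1‖) ^ 2 := by
            apply div_le_div_of_nonneg_right _ (by positivity)
            gcongr
      _ ≤ 16 * K * (3 * ‖a‖) ^ 2 / (7 * r / 8) ^ 2 :=
            div_le_div_of_nonneg_left (by positivity) (by positivity) hden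
      _ = (9216 / 49) * (K * ‖a‖ ^ 2 / r ^ 2) := by
            field_simp; ring
      _ ≤ 192 * (K * ‖a‖ ^ 2 / r ^ 2) :=
            mul_le_mul_of_nonneg_right (by norm_num) (by positivity)
      _ = 192 * K * ‖a‖ ^ 2 / r ^ 2 := by ring
  have hT2' : ‖fderiv ℂ (fun U => mlog (M U)) Z V - meanCLM ι 𝔄 V‖
      ≤ 192 * K * ‖a‖ * ‖Z - 1‖ / r ^ 2 := by
    calc ‖fderiv ℂ (fun U => mlog (M U)) Z V - meanCLM ι 𝔄 V‖
          ≤ 64 * K * ‖V‖ * ‖Z - 1‖ / r ^ 2 := hT2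
      _ ≤ 64 * K * (3 * ‖a‖) * ‖Z - 1‖ / r ^ 2 := by gcongr
      _ = 192 * K * ‖a‖ * ‖Z - 1‖ / r ^ 2 := by ring
  -- assemble
  have key : mlog (M (Z + V)) - mlog (M Z) - meanCLM ι 𝔄 a
      = (mlog (M (Z + V)) - mlog (M Z) - fderiv ℂ (fun U => mlog (M U)) Z V)
        + (fderiv ℂ (fun U => mlog (M U)) Z V - meanCLM ι 𝔄 V)
        + (meanCLM ι 𝔄 V - meanCLM ι 𝔄 a) := by abel
  rw [← hZV, key]
  have hsum := (norm_add₃_le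
    (a := mlog (M (Z + V)) - mlog (M Z) - fderiv ℂ (fun U => mlog (M U)) Z V)
    (b := fderiv ℂ (fun U => mlog (M U)) Z V - meanCLM ι 𝔄 V)
    (c := meanCLM ι 𝔄 V - meanCLM ι 𝔄 a))
  have hRHS : 192 * K * ‖a‖ ^ 2 / r ^ 2 + 192 * K * ‖a‖ * ‖Z - 1‖ / r ^ 2
      + (‖a‖ ^ 2 + 2 * ‖a‖ * ‖Z - 1‖)
      = (2 + 192 * K / r ^ 2) * ‖a‖ * ‖Z - 1‖ + (1 + 192 * K / r ^ 2) * ‖a‖ ^ 2 := by ring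
  linarith

end IsAnalyticMean

end Mean

end B7TransferAnalyticMean

end Literature.MathematicalPhysics.QuantumFieldTheory.Balaban1983to89

end
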